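import Literature.AlgebraicGeometry.Resolution.StalkBaseChangeChart
import Literature.AlgebraicGeometry.Resolution.SmoothUniformizationProofs
import Literature.AlgebraicGeometry.Resolution.SmoothOfRegularFibre
import Literature.AlgebraicGeometry.Resolution.DerivativeIdealsSupport
import Literature.AlgebraicGeometry.Resolution.EtaleLocalAlgebra
import Literature.AlgebraicGeometry.Resolution.StrictNormalCrossingsPoints
import Literature.AlgebraicGeometry.Resolution.StalkIdealLemmas
import Literature.AlgebraicGeometry.Resolution.FormalNormalCrossingsEtale
import Literature.AlgebraicGeometry.Resolution.NormalCrossingsBlowupStepReduction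
import Literature.AlgebraicGeometry.Resolution.AlterationsEnlargingZ
import Literature.AlgebraicGeometry.Resolution.AlterationsPreSemiStablePullback
import Literature.AlgebraicGeometry.Resolution.AlterationsSemiStableCodimTwo
import Literature.AlgebraicGeometry.Resolution.RegularLocalRingsFlatDescent
import Literature.AlgebraicGeometry.Motives.FiberStalk
import Literature.AlgebraicGeometry.Motives.BaseChangeProofs
import Literature.AlgebraicGeometry.Motives.GeometricallyIntegralAlgClosed
import Literature.AlgebraicGeometry.Motives.ClosedSubvarietyOfPoint
import Literature.AlgebraicGeometry.Motives.ReducedClosedSubschemeIso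
import Literature.AlgebraicGeometry.Dimension.FibreLocalRingDimension
import Literature.AlgebraicGeometry.Motives.AffineLineProduct
import HarnessLib

/-!
# De Jong's Situation 4.23 over an algebraically closed overfield (base change of the pair)

Topic: `Literature/AlgebraicGeometry/Resolution`. De Jong 1996 formulates semi-stability through
ALL geometric fibres (2.21: "for every algebraically closed field `K` and every `s̄ : Spec K → S` …");
to read the geometric fibre over `s̄ : Spec K → Y` of a family built from a pair in Situation 4.23
(`DeJong1996.SemiStablePair f g D τ` over an algebraically closed `k`) as a CLOSED fibre, one base
changes the whole situation to `K` (`K` becomes a `k`-algebra through `s̄`). This file proves that the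
base change is again a pair in Situation 4.23 (`DeJong1996.SemiStablePair.baseChange_field`):

* `isRegularLocalRing_stalk_pullback_field` — `Y ×_k Spec K` is regular for `Y` regular, locally of
  finite type over a perfect `k`: its local rings are localisations of `𝒪_{Y,y} ⊗_k K`
  (`StalkBaseChangeChart.lean`), formally smooth and essentially of finite type over `K`
  (`𝒪_{Y,y}` is formally smooth over the perfect field `k`, Stacks 00TV), hence regular
  (`isRegularLocalRing_of_formallySmooth_of_essFiniteType`, EGA IV₄ 17.5.8 (iii));
* `isRegularLocalRing_fibreRing_pullback_fst` — the closed fibre rings of `Y ×_k Spec K → Y` are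
  regular (local rings of `Spec (κ(y) ⊗_k K)`);
* `IsStrictNormalCrossingsDivisor.preimage_pullback_fst_field` — strict normal crossings divisors
  pull back (Matsumura 15.1: along the flat local map with regular closed fibre the local equations
  stay part of a regular system of parameters; the ideal of the preimage is the radical of the
  extended ideal, `vanishingIdeal_preimage_eq_radical_comap`, and `(x₁ ⋯ x_r)` is radical,
  `IsRsopPart.isRadical_span_prod`);
* `exists_comap_vanishingIdeal_closure_eq`, `mem_singularLocusCodimLE_of_generic_fibre` — the centre
  `T = cl{x}` of 3.4 pulls back to `cl{x_K}` with the same (pulled-back) ideal sheaf and `x_K` again a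
  codimension-`≤ 2` singular point, when `X_K ×_X T` is integral (geometric integrality over the
  algebraically closed `k`);
* `DeJong1996.SemiStablePair.baseChange_field` — the assembly (integrality: GW 5.56 via
  `geometricallyIntegral_of_isAlgClosed`; projectivity: Liu 3.1.23 via `IsProjectiveOver.baseChange_obj`;
  semi-stability: Liu 10.3.15 (a); smoothness off `D_K` and the sections by base change, as in
  `AlterationsPreSemiStablePullback.lean`).

## Sources

* A. J. de Jong, *Smoothness, semi-stability and alterations*, Publ. Math. IHÉS 83 (1996), 2.21,
  4.23. [DeJong1996]
* H. Matsumura, *Commutative Ring Theory* (1986), Thm. 15.1, Thm. 23.7. [Matsumura1987]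
* The Stacks Project, Tag 00TV. [StacksProject]
-/

noncomputable section

open CategoryTheory CategoryTheory.Limits AlgebraicGeometry TopologicalSpace TensorProduct IsLocalRing

namespace Literature.AlgebraicGeometry.Resolution

universe u

section FieldBaseChange

variable {k : Type u} [Field k] {Y : Scheme.{u}} (q : Y ⟶ Spec (.of k)) (y₀ : Y)

/-- The `k`-algebra structure of `StalkOver q y₀ = 𝒪_{Y,y₀}` is the `k`-structure of the scheme
`Y → Spec k` at `y₀` (`stalkHom (overHom k Y)`). [folklore] -/
theorem algebraMap_stalkOver_eq_stalkHom :
    letI : Y.Over (Spec (.of k)) := ⟨q⟩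
    (algebraMap k (StalkOver q y₀) : k →+* StalkOver q y₀) = stalkHom (overHom k Y) y₀ := by
  letI : Y.Over (Spec (.of k)) := ⟨q⟩
  -- `Spec` of both sides is `Spec 𝒪_{Y,y₀} → Y → Spec k`
  have h : Spec.map (CommRingCat.ofHom (algebraMap k (StalkOver q y₀))) =
      Spec.map (StructureSheaf.toStalk k (q y₀) ≫ q.stalkMap y₀ ≫ (StalkOver.iso q y₀).hom) := by
    rw [← fromSpecStalk_comp_eq, StalkOver.fromSpec, Category.assoc, ← Scheme.SpecMap_stalkMap_fromSpecStalk,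
      Spec.fromSpecStalk_eq', Spec.map_comp, Spec.map_comp, Category.assoc]
    rfl
  have h2 := congrArg CommRingCat.Hom.hom (Spec.map_injective h)
  rw [CommRingCat.hom_ofHom] at h2
  rw [h2, stalkHom, overHom, StructureSheaf.toStalk, Category.assoc]
  change ((CommRingCat.ofHom (algebraMap k _) ≫ (Spec (.of k)).presheaf.germ ⊤ (q y₀) trivial ≫
    q.stalkMap y₀ ≫ (StalkOver.iso q y₀).hom)).hom = _
  erw [Scheme.Hom.germ_stalkMap_assoc q ⊤ y₀ trivial]
  rfl

variable [LocallyOfFiniteType q]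

/-- The local ring `𝒪_{Y,y₀}` of a scheme locally of finite type over `k` is essentially of finite
type over `k` (for the `k`-structure of `StalkOver`). [folklore] -/
theorem essFiniteType_stalkOver : Algebra.EssFiniteType k (StalkOver q y₀) := by
  letI : Y.Over (Spec (.of k)) := ⟨q⟩
  haveI : LocallyOfFiniteType (Y ↘ Spec (.of k)) := ‹LocallyOfFiniteType q›
  have h : (inferInstance : Algebra k (StalkOver q y₀)) = stalkAlgebra (overHom k Y) y₀ :=
    Algebra.algebra_ext _ _ fun r => RingHom.congr_fun (algebraMap_stalkOver_eq_stalkHom q y₀) r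
  have h2 := essFiniteType_stalk_overHom k Y y₀
  rw [← h] at h2
  exact h2

/-- **The base change `Y ×_k Spec K` of a regular scheme locally of finite type over a perfect
field `k` to any field `K ⊇ k` is regular**: the local ring at a point over `y₀` is a localisation
of `𝒪_{Y,y₀} ⊗_k K` (`stalkTensorChart`); `𝒪_{Y,y₀}` is regular and essentially of finite type over
the perfect field `k`, hence formally smooth over `k` (Stacks 00TV), so the localisation is
formally smooth and essentially of finite type over `K`, hence regular (EGA IV₄ 17.5.8 (iii) over a
field, `isRegularLocalRing_of_formallySmooth_of_essFiniteType`).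
[cite: StacksProject, Tag 00TV] -/
theorem isRegularLocalRing_stalk_pullback_field [PerfectField k]
    (hreg : ∀ y : Y, IsRegularLocalRing (Y.presheaf.stalk y))
    (K : Type u) [Field K] [Algebra k K] (y' : ↑(pullback q (specOfAlgebra k K))) :
    IsRegularLocalRing ((pullback q (specOfAlgebra k K)).presheaf.stalk y') := by
  set y₀ := pullback.fst q (specOfAlgebra k K) y' with hy₀
  obtain ⟨t, ht⟩ := exists_stalkTensorChart_eq K q y₀ y' (by rw [hy₀])
  rw [← ht]
  set C := StalkOver q y₀ with hC
  haveI : IsRegularLocalRing C := hreg y₀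
  haveI : Algebra.EssFiniteType k C := essFiniteType_stalkOver q y₀
  haveI : Algebra.FormallySmooth k C := formallySmooth_of_isRegularLocalRing_of_perfectField k C
  -- `T = C ⊗_k K` is formally smooth and essentially of finite type over `K`
  set T := C ⊗[k] K with hT
  letI algKT : Algebra K T := Algebra.TensorProduct.rightAlgebra
  let κ : (K ⊗[k] C) ≃ₐ[K] T :=
    AlgEquiv.ofRingEquiv (f := (Algebra.TensorProduct.comm k K C).toRingEquiv) (fun x => by
      change Algebra.TensorProduct.comm k K C (x ⊗ₜ[k] (1 : C)) = (1 : C) ⊗ₜ[k] x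
      rfl)
  haveI : Algebra.FormallySmooth K T := Algebra.FormallySmooth.of_equiv κ
  haveI : Algebra.EssFiniteType K T := (Algebra.EssFiniteType.iff_of_algEquiv κ).mp inferInstance
  -- the stalk at `t` is a localisation of `T`
  set St : Type u := ↥((Spec (.of T)).presheaf.stalk t) with hSt
  letI algSt : Algebra T St := (StructureSheaf.toStalk T t).hom.toAlgebra
  haveI : IsLocalization.AtPrime St t.asIdeal := StructureSheaf.IsLocalization.to_stalk T t
  letI algKSt : Algebra K St := ((algebraMap T St).comp (algebraMap K T)).toAlgebra
  haveI : IsScalarTower K T St := IsScalarTower.of_algebraMap_eq fun _ => rfl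
  haveI : Algebra.FormallySmooth T St := Algebra.FormallySmooth.of_isLocalization t.asIdeal.primeCompl
  haveI : Algebra.FormallySmooth K St := Algebra.FormallySmooth.comp K T St
  haveI : Algebra.EssFiniteType T St := Algebra.EssFiniteType.of_isLocalization St t.asIdeal.primeCompl
  haveI : Algebra.EssFiniteType K St := Algebra.EssFiniteType.comp K T St
  haveI : IsRegularLocalRing St := isRegularLocalRing_of_formallySmooth_of_essFiniteType K St
  exact IsRegularLocalRing.of_ringEquiv (asIso ((stalkTensorChart K q y₀).stalkMap t)).symm.commRingCatIsoToRingEquiv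

end FieldBaseChange


/-! ## Regularity of the localisations of `C ⊗_k K` -/

section RegularTensor

variable (k : Type u) [Field k] [PerfectField k] (C : Type u) [CommRing C] [Algebra k C]
  (K : Type u) [Field K] [Algebra k K]

/-- **For a regular local ring `C` essentially of finite type over a perfect field `k` and any
field `K ⊇ k`, every localisation of `C ⊗_k K` at a prime is a regular local ring**: `C` is
formally smooth over `k` (Stacks 00TV), so `C ⊗_k K` and its localisations are formally smooth and
essentially of finite type over `K`, hence regular. [cite: StacksProject, Tag 00TV] -/
theorem isRegularLocalRing_of_isLocalization_tensor_field [Algebra.EssFiniteType k C]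
    [IsRegularLocalRing C] (𝔮 : Ideal (C ⊗[k] K)) [𝔮.IsPrime] (L : Type u) [CommRing L]
    [Algebra (C ⊗[k] K) L] [IsLocalization.AtPrime L 𝔮] : IsRegularLocalRing L := by
  haveI : Algebra.FormallySmooth k C := formallySmooth_of_isRegularLocalRing_of_perfectField k C
  set T := C ⊗[k] K with hT
  letI algKT : Algebra K T := Algebra.TensorProduct.rightAlgebra
  let κ : (K ⊗[k] C) ≃ₐ[K] T :=
    AlgEquiv.ofRingEquiv (f := (Algebra.TensorProduct.comm k K C).toRingEquiv) (fun x => by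
      change Algebra.TensorProduct.comm k K C (x ⊗ₜ[k] (1 : C)) = (1 : C) ⊗ₜ[k] x
      rfl)
  haveI : Algebra.FormallySmooth K T := Algebra.FormallySmooth.of_equiv κ
  haveI : Algebra.EssFiniteType K T := (Algebra.EssFiniteType.iff_of_algEquiv κ).mp inferInstance
  letI algKL : Algebra K L := ((algebraMap T L).comp (algebraMap K T)).toAlgebra
  haveI : IsScalarTower K T L := IsScalarTower.of_algebraMap_eq fun _ => rfl
  haveI : IsLocalRing L := IsLocalization.AtPrime.isLocalRing L 𝔮
  haveI : Algebra.FormallySmooth T L := Algebra.FormallySmooth.of_isLocalization 𝔮.primeCompl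
  haveI : Algebra.FormallySmooth K L := Algebra.FormallySmooth.comp K T L
  haveI : Algebra.EssFiniteType T L := Algebra.EssFiniteType.of_isLocalization L 𝔮.primeCompl
  haveI : Algebra.EssFiniteType K L := Algebra.EssFiniteType.comp K T L
  exact isRegularLocalRing_of_formallySmooth_of_essFiniteType K L

end RegularTensor





/-! ## The fibre rings of `Y ×_k Spec K → Y` -/

section FibreRing

variable {k : Type u} [Field k] {Y : Scheme.{u}} (q : Y ⟶ Spec (.of k)) (y₀ : Y)

/-! The `k`-algebra structure of `κ(y₀)` (through `Spec κ(y₀) → Y → Spec k`) is the landed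
`Motives.AffineLineProduct.residueFieldAlgebra` for the `k`-scheme `Over.mk q`; it is introduced with
`letI` where needed. That `Spec κ(y₀) → Y → Spec k` is `Spec` of the structure map is
`Literature.AlgebraicGeometry.Dimension.fromSpecResidueField_comp_eq` (the two `k`-algebra structures
agree definitionally). -/

/-- The `k`-structure of `κ(y₀)` is the residue map after that of `𝒪_{Y,y₀}`. [folklore] -/
theorem algebraMap_residueField_eq_residue_comp :
    letI : Algebra k (Y.residueField y₀) :=
      @Literature.AlgebraicGeometry.Motives.AffineLineProduct.residueFieldAlgebra k _ (Over.mk q) y₀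
    (algebraMap k (Y.residueField y₀) : k →+* Y.residueField y₀) =
      (Y.residue y₀).hom.comp (algebraMap k (StalkOver q y₀)) := by
  letI : Algebra k (Y.residueField y₀) :=
      @Literature.AlgebraicGeometry.Motives.AffineLineProduct.residueFieldAlgebra k _ (Over.mk q) y₀
  have h : Spec.map (CommRingCat.ofHom (algebraMap k (Y.residueField y₀))) =
      Spec.map (CommRingCat.ofHom (algebraMap k (StalkOver q y₀)) ≫ Y.residue y₀) := by
    -- `Spec κ(y₀) → Y → Spec k` is `Spec` of the structure map (`Dimension.fromSpecResidueField_comp_eq`;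
    -- the two `k`-algebra structures on `κ(y₀)` agree definitionally)
    refine (Literature.AlgebraicGeometry.Dimension.fromSpecResidueField_comp_eq q y₀).symm.trans ?_
    rw [Spec.map_comp, Scheme.fromSpecResidueField, Category.assoc, ← fromSpecStalk_comp_eq q y₀,
      StalkOver.fromSpec, StalkOver.iso, Iso.refl_hom]
    erw [Spec.map_id, Category.id_comp]
    rfl
  have h2 := congrArg CommRingCat.Hom.hom (Spec.map_injective h)
  rwa [CommRingCat.hom_ofHom, CommRingCat.hom_comp, CommRingCat.hom_ofHom] at h2

variable [LocallyOfFiniteType q]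

/-- `κ(y₀)` is essentially of finite type over `k`. [folklore] -/
theorem essFiniteType_residueField :
    letI : Algebra k (Y.residueField y₀) :=
      @Literature.AlgebraicGeometry.Motives.AffineLineProduct.residueFieldAlgebra k _ (Over.mk q) y₀
    Algebra.EssFiniteType k (Y.residueField y₀) := by
  letI : Algebra k (Y.residueField y₀) :=
      @Literature.AlgebraicGeometry.Motives.AffineLineProduct.residueFieldAlgebra k _ (Over.mk q) y₀
  letI : Algebra (StalkOver q y₀) (Y.residueField y₀) := (Y.residue y₀).hom.toAlgebra
  haveI : IsScalarTower k (StalkOver q y₀) (Y.residueField y₀) :=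
    IsScalarTower.of_algebraMap_eq fun r => RingHom.congr_fun (algebraMap_residueField_eq_residue_comp q y₀) r
  haveI : Algebra.EssFiniteType k (StalkOver q y₀) := essFiniteType_stalkOver q y₀
  haveI : Algebra.EssFiniteType (StalkOver q y₀) (Y.residueField y₀) :=
    Algebra.EssFiniteType.of_surjective (Algebra.ofId (StalkOver q y₀) (Y.residueField y₀))
      (fun x => by
        obtain ⟨a, ha⟩ := Ideal.Quotient.mk_surjective x
        exact ⟨a, ha⟩)
  exact Algebra.EssFiniteType.comp k (StalkOver q y₀) (Y.residueField y₀)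

variable [PerfectField k] (K : Type u) [Field K] [Algebra k K]

/-- **The closed fibre rings of `Y ×_k Spec K → Y` are regular**: at a point `p` over `y₀`,
`𝒪_{Y_K,p}/𝔪_{y₀} 𝒪_{Y_K,p}` is the local ring of the fibre `(Y_K)_{y₀} ≅ Spec (κ(y₀) ⊗_k K)` at the
point corresponding to `p` (Liu, proof of Thm. 4.3.36), a localisation of `κ(y₀) ⊗_k K`, regular by
`isRegularLocalRing_of_isLocalization_tensor_field`. [folklore] -/
theorem isRegularLocalRing_fibreRing_pullback_fst (p : ↑(pullback q (specOfAlgebra k K))) :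
    IsRegularLocalRing ((pullback q (specOfAlgebra k K)).presheaf.stalk p ⧸
      (maximalIdeal (Y.presheaf.stalk (pullback.fst q (specOfAlgebra k K) p))).map
        ((pullback.fst q (specOfAlgebra k K)).stalkMap p).hom) := by
  -- `p` as a point of the fibre over `y₀ = fst p`
  obtain ⟨z, hz⟩ : p ∈ Set.range ((pullback.fst q (specOfAlgebra k K)).fiberι (pullback.fst q (specOfAlgebra k K) p)) := by
    rw [Scheme.Hom.range_fiberι]; rfl
  obtain ⟨e₀⟩ := Literature.AlgebraicGeometry.Motives.nonempty_stalkFiber_ringEquiv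
    (pullback.fst q (specOfAlgebra k K)) (pullback.fst q (specOfAlgebra k K) p) z
  letI : Algebra k (Y.residueField (pullback.fst q (specOfAlgebra k K) p)) :=
    @Literature.AlgebraicGeometry.Motives.AffineLineProduct.residueFieldAlgebra k _ (Over.mk q)
      (pullback.fst q (specOfAlgebra k K) p)
  haveI : Algebra.EssFiniteType k (Y.residueField (pullback.fst q (specOfAlgebra k K) p)) :=
    essFiniteType_residueField q _
  -- the fibre is `Spec (κ(y₀) ⊗_k K)`
  let efib : (pullback.fst q (specOfAlgebra k K)).fiber (pullback.fst q (specOfAlgebra k K) p) ≅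
      Spec (.of (Y.residueField (pullback.fst q (specOfAlgebra k K) p) ⊗[k] K)) :=
    pullbackSymmetry _ _ ≪≫
      pullbackRightPullbackFstIso q (specOfAlgebra k K) (Y.fromSpecResidueField _) ≪≫
        pullback.congrHom (Literature.AlgebraicGeometry.Dimension.fromSpecResidueField_comp_eq q _) rfl ≪≫
          pullbackSpecIso k _ K
  -- the local ring of the fibre at `z` is a localisation of `κ(y₀) ⊗_k K`, hence regular
  set w := efib.hom z with hw
  let St : Type u := ↥((Spec (.of (Y.residueField (pullback.fst q (specOfAlgebra k K) p) ⊗[k] K))).presheaf.stalk w)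
  letI : Algebra (Y.residueField (pullback.fst q (specOfAlgebra k K) p) ⊗[k] K) St :=
    (StructureSheaf.toStalk _ w).hom.toAlgebra
  haveI : IsLocalization.AtPrime St w.asIdeal := StructureSheaf.IsLocalization.to_stalk _ w
  haveI : IsRegularLocalRing St :=
    isRegularLocalRing_of_isLocalization_tensor_field k (Y.residueField _) K w.asIdeal St
  haveI : IsRegularLocalRing (((pullback.fst q (specOfAlgebra k K)).fiber
      (pullback.fst q (specOfAlgebra k K) p)).presheaf.stalk z) :=
    IsRegularLocalRing.of_ringEquiv (asIso (efib.hom.stalkMap z)).commRingCatIsoToRingEquiv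
  have hreg := IsRegularLocalRing.of_ringEquiv e₀
  rw [← hz]
  exact hreg

end FibreRing

/-! ## Strict normal crossings and the base field -/

section SNCBaseChange

variable {k : Type u} [Field k] [PerfectField k] {Y : Scheme.{u}} (q : Y ⟶ Spec (.of k))
  [LocallyOfFiniteType q] (K : Type u) [Field K] [Algebra k K]

/-- In a local ring with a surjection onto a local ring, membership in the maximal ideal is tested
downstairs. [folklore] -/
theorem mem_maximalIdeal_iff_mk_mem {B : Type u} [CommRing B] [IsLocalRing B] {I : Ideal B}
    [IsLocalRing (B ⧸ I)] (b : B) : b ∈ maximalIdeal B ↔ Ideal.Quotient.mk I b ∈ maximalIdeal (B ⧸ I) := by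
  haveI : IsLocalHom (Ideal.Quotient.mk I) := IsLocalHom.of_surjective _ Ideal.Quotient.mk_surjective
  constructor
  · exact fun h => map_nonunit (Ideal.Quotient.mk I) b h
  · intro h
    rw [IsLocalRing.mem_maximalIdeal, mem_nonunits_iff]
    intro hu
    exact (IsLocalRing.mem_maximalIdeal _).mp h (hu.map _)

/-- **Strict normal crossings divisors are stable under extension of a perfect base field**: for
`Y` regular, locally of finite type over a perfect field `k`, `D ⊂ Y` with strict normal crossings
and any field `K ⊇ k`, the preimage of `D` in `Y_K = Y ×_k Spec K` has strict normal crossings. At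
`p ∈ Y_K` over `y ∈ D` with local equations `x₁ ⋯ x_r` of `D` (part of a regular system of
parameters of `𝒪_{Y,y}`): `𝒪_{Y,y} → 𝒪_{Y_K,p}` is flat and local, `𝒪_{Y_K,p}` is regular
(`isRegularLocalRing_stalk_pullback_field`) with regular closed fibre ring `F`
(`isRegularLocalRing_fibreRing_pullback_fst`), so its maximal ideal is generated by the images of a
regular system of parameters of `𝒪_{Y,y}` together with lifts of one of `F`, and
`dim 𝒪_{Y_K,p} = dim 𝒪_{Y,y} + dim F` (Matsumura 15.1) — the images of the `xᵢ` are part of a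
regular system of parameters; and the ideal of the preimage of `D` is the radical of the extended
ideal (`vanishingIdeal_preimage_eq_radical_comap`), i.e. `(∏ xᵢ)` again
(`IsRsopPart.isRadical_span_prod`). [cite: Matsumura1987, Thm. 15.1 and Thm. 23.7] -/
theorem IsStrictNormalCrossingsDivisor.preimage_pullback_fst_field
    (hreg : ∀ y : Y, IsRegularLocalRing (Y.presheaf.stalk y)) {D : Set Y}
    (hD : IsStrictNormalCrossingsDivisor Y D) :
    IsStrictNormalCrossingsDivisor (pullback q (specOfAlgebra k K))
      ((pullback.fst q (specOfAlgebra k K)) ⁻¹' D) := by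
  classical
  set P := pullback q (specOfAlgebra k K) with hP
  set fst := pullback.fst q (specOfAlgebra k K) with hfst
  haveI : Flat (specOfAlgebra k K) := Flat.SpecMap_iff.mpr (RingHom.flat_algebraMap_iff.mpr inferInstance)
  haveI : Flat fst := inferInstance
  have hDcl : IsClosed D := hD.isClosed
  have hclD : (⟨closure D, isClosed_closure⟩ : Closeds Y) = ⟨D, hDcl⟩ := Closeds.ext hDcl.closure_eq
  have hclDK : (⟨closure (fst ⁻¹' D), isClosed_closure⟩ : Closeds P) =
      ⟨fst ⁻¹' D, hDcl.preimage fst.continuous⟩ := Closeds.ext (hDcl.preimage fst.continuous).closure_eq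
  rw [isStrictNormalCrossingsDivisor_iff_stalkIdeal] at hD ⊢
  obtain ⟨-, hD⟩ := hD
  refine ⟨hDcl.preimage fst.continuous, fun p hp => ?_⟩
  obtain ⟨hregy, r, e, xv, yv, hr, hdim, hspan, hI⟩ := hD (fst p) hp
  rw [hclD] at hI
  -- the flat local homomorphism `A = 𝒪_{Y,y} → B = 𝒪_{Y_K,p}`, its regular fibre ring `F`
  letI : Algebra (Y.presheaf.stalk (fst p)) (P.presheaf.stalk p) := (fst.stalkMap p).hom.toAlgebra
  haveI : Module.Flat (Y.presheaf.stalk (fst p)) (P.presheaf.stalk p) := Flat.stalkMap fst p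
  haveI hφloc : IsLocalHom (algebraMap (Y.presheaf.stalk (fst p)) (P.presheaf.stalk p)) :=
    inferInstanceAs (IsLocalHom (fst.stalkMap p).hom)
  haveI : IsRegularLocalRing (Y.presheaf.stalk (fst p)) := hregy
  haveI hBreg : IsRegularLocalRing (P.presheaf.stalk p) := isRegularLocalRing_stalk_pullback_field q hreg K p
  haveI hFreg : IsRegularLocalRing (P.presheaf.stalk p ⧸ (maximalIdeal (Y.presheaf.stalk (fst p))).map
      (algebraMap (Y.presheaf.stalk (fst p)) (P.presheaf.stalk p))) :=
    isRegularLocalRing_fibreRing_pullback_fst q K p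
  have hdimB := ringKrullDim_eq_add_of_flat (R := Y.presheaf.stalk (fst p)) (S := P.presheaf.stalk p)
  set φ := algebraMap (Y.presheaf.stalk (fst p)) (P.presheaf.stalk p) with hφ
  set IF := (maximalIdeal (Y.presheaf.stalk (fst p))).map φ with hIF
  haveI hFloc : IsLocalRing (P.presheaf.stalk p ⧸ IF) := by rw [hIF]; infer_instance
  haveI hFreg' : IsRegularLocalRing (P.presheaf.stalk p ⧸ IF) := by rw [hIF]; exact hFreg
  -- a regular system of parameters of `F`, lifted to `B`
  obtain ⟨-, eF, w, hdimF, hspanF⟩ := isRsopPart_of_isRegularLocalRing_zero (R := P.presheaf.stalk p ⧸ IF) Fin.elim0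
  rw [Set.range_eq_empty, Set.empty_union] at hspanF
  rw [Nat.zero_add] at hdimF
  choose wl hwl using fun j => Ideal.Quotient.mk_surjective (I := IF) (w j)
  have hwl' : (Ideal.Quotient.mk IF) ∘ wl = w := funext hwl
  have hzA : IsRsopPart xv := ⟨hregy, e, yv, hdim, hspan⟩
  have hmA : IF = Ideal.span (Set.range (φ ∘ xv) ∪ Set.range (φ ∘ yv)) := by
    rw [hIF, ← hspan, Ideal.map_span, Set.image_union, ← Set.range_comp, ← Set.range_comp]
  have hIFle : IF ≤ maximalIdeal (P.presheaf.stalk p) :=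
    ((local_hom_TFAE φ).out 0 2).mp hφloc
  -- `(x, y, w)` generate `𝔪_B`
  have hgen : Ideal.span (Set.range (φ ∘ xv) ∪ Set.range (Fin.append (φ ∘ yv) wl)) =
      maximalIdeal (P.presheaf.stalk p) := by
    rw [range_fin_append, ← Set.union_assoc, Ideal.span_union, ← hmA]
    apply le_antisymm
    · refine sup_le hIFle ?_
      rw [Ideal.span_le]
      rintro _ ⟨j, rfl⟩
      rw [SetLike.mem_coe, mem_maximalIdeal_iff_mk_mem (I := IF), hwl, ← hspanF]
      exact Ideal.subset_span ⟨j, rfl⟩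
    · intro m hm
      have h1 : Ideal.Quotient.mk IF m ∈ (Ideal.span (Set.range wl)).map (Ideal.Quotient.mk IF) := by
        rw [Ideal.map_span, ← Set.range_comp, hwl', hspanF]
        exact (mem_maximalIdeal_iff_mk_mem (I := IF) m).mp hm
      have h2 : m ∈ ((Ideal.span (Set.range wl)).map (Ideal.Quotient.mk IF)).comap (Ideal.Quotient.mk IF) := h1
      rw [Ideal.comap_map_of_surjective _ Ideal.Quotient.mk_surjective, ← RingHom.ker_eq_comap_bot,
        Ideal.mk_ker] at h2
      rw [sup_comm]
      exact h2
  have hdimB' : ringKrullDim (P.presheaf.stalk p) = ((r + (e + eF) : ℕ) : WithBot ℕ∞) := by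
    rw [hdimB, hdim, hdimF]
    push_cast
    rw [add_assoc]
  have hx' : IsRsopPart (φ ∘ xv) := ⟨hBreg, e + eF, Fin.append (φ ∘ yv) wl, hdimB', hgen⟩
  refine ⟨hBreg, r, e + eF, φ ∘ xv, Fin.append (φ ∘ yv) wl, hr, hdimB', hgen, ?_⟩
  -- the ideal of the preimage of `D` at `p`
  rw [hclDK, vanishingIdeal_preimage_eq_radical_comap fst hDcl, stalkIdeal_radical,
    stalkIdeal_comap_eq_map_stalkMap, hI, Ideal.map_span, Set.image_singleton, map_prod]
  exact (hx'.isRadical_span_prod).radical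

end SNCBaseChange

/-! ## The preimage of an irreducible closed subset under a base change with integral pieces -/

section Centre

open Scheme.IdealSheafData

variable {X XK : Scheme.{u}} (pX : XK ⟶ X) (x : X)

/-- **The preimage of `T = cl{x}` is again the closure of a point, with the same ideal sheaf
pulled back**, provided the base change `X_K ×_X T` of the reduced closed subscheme `T` is integral
and `pX` is onto: the pulled-back ideal sheaf is the kernel of the closed immersion
`X_K ×_X T → X_K` (Mathlib's `comap`), which is the ideal of its image `pX⁻¹(T)` because the source
is reduced, and `pX⁻¹(T)` is irreducible with generic point over `x`. [folklore] -/
theorem exists_comap_vanishingIdeal_closure_eq [Surjective pX]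
    [IsIntegral (pullback pX (vanishingIdeal (⟨closure {x}, isClosed_closure⟩ : Closeds X)).subschemeι)] :
    ∃ xK : XK, pX xK = x ∧ pX ⁻¹' closure ({x} : Set X) = closure {xK} ∧
      (vanishingIdeal (⟨closure {x}, isClosed_closure⟩ : Closeds X)).comap pX =
        vanishingIdeal ⟨closure {xK}, isClosed_closure⟩ := by
  set I := vanishingIdeal (⟨closure {x}, isClosed_closure⟩ : Closeds X) with hI
  set W := pullback pX I.subschemeι with hW
  set j := pullback.fst pX I.subschemeι with hj
  haveI : IsClosedImmersion j := inferInstance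
  -- the image of `j` is `pX⁻¹(T)`
  have hrange : Set.range j = pX ⁻¹' closure {x} := by
    rw [hj, Scheme.Pullback.range_fst, range_subschemeι, coe_support_vanishingIdeal]
    rfl
  -- the generic point
  let ξ := j (genericPoint W)
  have hclξ : closure ({ξ} : Set XK) = Set.range j := by
    have h1 : closure ({ξ} : Set XK) = j '' closure {genericPoint W} := by
      rw [← j.isClosedEmbedding.closure_image_eq, Set.image_singleton]
    rw [h1, genericPoint_closure, Set.image_univ]
  refine ⟨ξ, ?_, by rw [hclξ, hrange], ?_⟩
  · -- `pX ξ` is a generic point of `T`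
    have hmem : pX ξ ∈ closure ({x} : Set X) := by
      have : ξ ∈ Set.range j := ⟨_, rfl⟩
      rw [hrange] at this
      exact this
    have h1 : x ⤳ pX ξ := specializes_iff_mem_closure.mpr hmem
    have h2 : pX ξ ⤳ x := by
      rw [specializes_iff_mem_closure]
      obtain ⟨w, hw⟩ := pX.surjective x
      have hwT : w ∈ pX ⁻¹' closure ({x} : Set X) := by
        rw [Set.mem_preimage, hw]; exact subset_closure rfl
      rw [← hrange, ← hclξ] at hwT
      have h3 : ξ ⤳ w := specializes_iff_mem_closure.mpr hwT
      have h4 := h3.map pX.continuous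
      rw [hw] at h4
      exact specializes_iff_mem_closure.mp h4
    exact (h2.antisymm h1).eq
  · change j.ker = _
    rw [Literature.AlgebraicGeometry.Motives.ker_eq_vanishingIdeal_of_isReduced j]
    congr 1
    ext1
    change Set.range j = closure {ξ}
    rw [hclξ]

end Centre

/-! ## Codimension-`≤ 2` singular points lift to generic points of fibres -/

section Codim

variable {X XK : Scheme.{u}} (pX : XK ⟶ X) [Flat pX] [IsLocallyNoetherian X] [IsLocallyNoetherian XK]

/-- **A point generic in its (integral) fibre over a codimension-`≤ 2` singular point is a
codimension-`≤ 2` singular point**: along the flat local homomorphism `𝒪_{X,x} → 𝒪_{X_K,ξ}`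
non-regularity descends (Matsumura 23.7 (i)) and `dim 𝒪_{X_K,ξ} = dim 𝒪_{X,x} + dim (fibre ring)`
(Matsumura 15.1), the fibre ring being the local ring of the fibre scheme at its generic point, a
field. [cite: Matsumura1987, Thm. 15.1 and Thm. 23.7] -/
theorem mem_singularLocusCodimLE_of_generic_fibre (ξ : XK)
    (hx : pX ξ ∈ Scheme.singularLocusCodimLE X 2) [IsIntegral (pX.fiber (pX ξ))]
    (hgen : ∀ w : XK, pX w = pX ξ → ξ ⤳ w) : ξ ∈ Scheme.singularLocusCodimLE XK 2 := by
  set A : Type u := ↥(X.presheaf.stalk (pX ξ)) with hA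
  set B : Type u := ↥(XK.presheaf.stalk ξ) with hB
  letI : Algebra A B := (pX.stalkMap ξ).hom.toAlgebra
  haveI : Module.Flat A B := Flat.stalkMap pX ξ
  haveI : IsLocalHom (algebraMap A B) := inferInstanceAs (IsLocalHom (pX.stalkMap ξ).hom)
  refine ⟨fun hreg => hx.1 ?_, ?_⟩
  · haveI : IsRegularLocalRing B := hreg
    exact IsRegularLocalRing.of_flat_of_isLocalHom A B
  · -- the fibre ring is the local ring of the fibre at its generic point, a field
    obtain ⟨z, hz⟩ : ξ ∈ Set.range (pX.fiberι (pX ξ)) := by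
      rw [Scheme.Hom.range_fiberι]; rfl
    obtain ⟨e₀⟩ := Literature.AlgebraicGeometry.Motives.nonempty_stalkFiber_ringEquiv pX (pX ξ) z
    have hcl : closure ({z} : Set ↥(pX.fiber (pX ξ))) = Set.univ := by
      refine Set.eq_univ_of_forall fun z' => ?_
      rw [← specializes_iff_mem_closure, ← (pX.fiberι (pX ξ)).isEmbedding.isInducing.specializes_iff, hz]
      apply hgen
      have : pX.fiberι (pX ξ) z' ∈ Set.range (pX.fiberι (pX ξ)) := ⟨z', rfl⟩
      rwa [Scheme.Hom.range_fiberι] at this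
    have hF : IsField ((pX.fiber (pX ξ)).presheaf.stalk z) := by
      apply isField_stalk_of_closure_mem_irreducibleComponents
      rw [hcl, irreducibleComponents_eq_singleton]
      exact Set.mem_singleton _
    have hdimF : ringKrullDim (B ⧸ (maximalIdeal A).map (algebraMap A B)) = 0 := by
      have h1 : ringKrullDim (↑(XK.presheaf.stalk (pX.fiberι (pX ξ) z)) ⧸
          (maximalIdeal ↑(X.presheaf.stalk (pX (pX.fiberι (pX ξ) z)))).map
            (pX.stalkMap (pX.fiberι (pX ξ) z)).hom) = 0 := by
        rw [← ringKrullDim_eq_of_ringEquiv e₀]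
        letI := hF.toField
        exact ringKrullDim_eq_zero_of_field _
      rw [hz] at h1
      exact h1
    have hdim := ringKrullDim_eq_add_of_flat (R := A) (S := B)
    rw [hdimF, add_zero] at hdim
    rw [hdim]
    exact hx.2

end Codim

/-! ## Situation 4.23 over an algebraically closed overfield -/

namespace DeJong1996.SemiStablePair

variable {k : Type u} [Field k] {X Y : Scheme.{u}} {f : X ⟶ Y} {g : Y ⟶ Spec (.of k)}
  {D : Set Y} {n : ℕ} {τ : Fin n → (Y ⟶ X)}

/-- Projectivity over the base field descends along isomorphisms of schemes over the field.
[folklore] -/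
theorem _root_.Literature.AlgebraicGeometry.Motives.IsProjectiveOver.of_overIso {K : Type u} [Field K]
    {Z Z' : Literature.AlgebraicGeometry.Motives.SchemeOver K} (e : Z' ≅ Z)
    (h : Literature.AlgebraicGeometry.Motives.IsProjectiveOver Z) :
    Literature.AlgebraicGeometry.Motives.IsProjectiveOver Z' := by
  obtain ⟨m, ι, hι⟩ := h
  refine ⟨m, e.hom ≫ ι, ?_⟩
  rw [Over.comp_left]
  haveI := hι
  haveI : IsIso e.hom.left := inferInstanceAs (IsIso ((Over.forget _).map e.hom))
  infer_instance

/-- **Situation 4.23 is stable under extension of the algebraically closed base field** (used in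
de Jong 1996, 3.4 to read the geometric fibres of the blown-up curve over an arbitrary
algebraically closed `K ⊇ k` as closed fibres of the base-changed pair): for a pair in Situation
4.23 over `k` and an algebraically closed `K ⊇ k`, the family `X_K = X ×_Y Y_K → Y_K = Y ×_k Spec K`
with the divisor `D_K = pr⁻¹(D)` and the pulled-back sections is a pair in Situation 4.23 over `K`:
`X_K`, `Y_K` are integral (geometric integrality over an algebraically closed field, GW 5.56) and
projective over `K` (Liu 3.1.23); `Y_K` is nonsingular and `D_K` has strict normal crossings
(`isRegularLocalRing_stalk_pullback_field`, `IsStrictNormalCrossingsDivisor.preimage_pullback_fst_field`);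
`X_K → Y_K` is a semi-stable curve (Liu 10.3.15 (a)), smooth over `Y_K ∖ D_K`, and the sections stay
disjoint sections into the smooth locus (base change). [cite: DeJong1996, 4.23, p. 75] -/
theorem baseChange_field [IsAlgClosed k] (hS : SemiStablePair f g D τ) (K : Type u) [Field K]
    [IsAlgClosed K] [Algebra k K] :
    SemiStablePair (pullback.snd f (pullback.fst g (specOfAlgebra k K)))
      (pullback.snd g (specOfAlgebra k K)) ((pullback.fst g (specOfAlgebra k K)) ⁻¹' D)
      (PreSemiStablePair.pullbackSection hS.comp_eq_id (pullback.fst g (specOfAlgebra k K))) := by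
  set bc := specOfAlgebra k K with hbc
  set ψ := pullback.fst g bc with hψ
  haveI := hS.isIntegral
  haveI := hS.isIntegral_base
  haveI := hS.locallyOfFiniteType
  haveI : IsProper g :=
    Literature.AlgebraicGeometry.Motives.IsProjectiveOver.isProper (X := Over.mk g) hS.isProjectiveOver_base
  haveI : IsSeparated g := inferInstance
  haveI : LocallyOfFiniteType g := inferInstance
  -- `Y_K`, `X_K` integral
  haveI hgi : GeometricallyIntegral g := Literature.AlgebraicGeometry.Motives.geometricallyIntegral_of_isAlgClosed g
  haveI hfgi : GeometricallyIntegral (f ≫ g) :=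
    Literature.AlgebraicGeometry.Motives.geometricallyIntegral_of_isAlgClosed (f ≫ g)
  haveI : IsIntegral (pullback g bc) := GeometricallyIntegral.isIntegral_of_subsingleton (pullback.snd g bc)
  haveI : IsIntegral (pullback (f ≫ g) bc) := GeometricallyIntegral.isIntegral_of_subsingleton (pullback.snd (f ≫ g) bc)
  let eX : pullback f ψ ≅ pullback (f ≫ g) bc := pullbackRightPullbackFstIso g bc f
  haveI : IsIntegral (pullback f ψ) := IsIntegral.of_isIso eX.inv
  -- projectivity
  have hprojY : Literature.AlgebraicGeometry.Motives.IsProjectiveOver (Over.mk (pullback.snd g bc)) :=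
    Literature.AlgebraicGeometry.Motives.IsProjectiveOver.baseChange_obj (L := K) (X := Over.mk g)
      hS.isProjectiveOver_base
  have hprojX : Literature.AlgebraicGeometry.Motives.IsProjectiveOver
      (Over.mk (pullback.snd f ψ ≫ pullback.snd g bc)) := by
    have h1 := Literature.AlgebraicGeometry.Motives.IsProjectiveOver.baseChange_obj (L := K)
      (X := Over.mk (f ≫ g)) hS.isProjectiveOver
    refine Literature.AlgebraicGeometry.Motives.IsProjectiveOver.of_overIso ?_ h1
    refine Over.isoMk eX ?_
    change eX.hom ≫ pullback.snd (f ≫ g) bc = pullback.snd f ψ ≫ pullback.snd g bc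
    exact pullbackRightPullbackFstIso_hom_snd g bc f
  -- regularity of `Y_K` and strict normal crossings of `D_K`
  have hreg : Scheme.IsRegular (pullback g bc) := fun y =>
    isRegularLocalRing_stalk_pullback_field g hS.isRegular_base K y
  have hD : IsStrictNormalCrossingsDivisor (pullback g bc) (ψ ⁻¹' D) :=
    IsStrictNormalCrossingsDivisor.preimage_pullback_fst_field g K hS.isRegular_base hS.isStrictNormalCrossingsDivisor
  refine
    { isIntegral := ‹_›
      isProjectiveOver := hprojX
      isIntegral_base := ‹_›
      isProjectiveOver_base := hprojY
      isRegular_base := hreg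
      isStrictNormalCrossingsDivisor := hD
      isSemiStableCurve := hS.isSemiStableCurve.baseChange ψ
      smooth_morphismRestrict := ?_
      comp_eq_id := fun i => PreSemiStablePair.pullbackSection_snd hS.comp_eq_id ψ i
      pairwise_disjoint := ?_
      exists_smooth := ?_ }
  · -- smoothness over `Y_K ∖ ψ⁻¹(D) = ψ⁻¹(Y ∖ D)`: a base change of `f` over `Y ∖ D`
    let U : Y.Opens := ⟨Dᶜ, hS.isStrictNormalCrossingsDivisor.isClosed.isOpen_compl⟩
    have hV : (⟨(ψ ⁻¹' D)ᶜ, hD.isClosed.isOpen_compl⟩ : (pullback g bc).Opens) = ψ ⁻¹ᵁ U := rfl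
    rw [hV]
    have hfU : Smooth ((f ⁻¹ᵁ U).ι ≫ f) := by
      rw [← morphismRestrict_ι]
      haveI := hS.smooth_morphismRestrict
      infer_instance
    have h1 := ι_comp_pullback_snd_of_ι_comp (P := @Smooth) f ψ (f ⁻¹ᵁ U) hfU
    have he : pullback.fst f ψ ⁻¹ᵁ (f ⁻¹ᵁ U) = pullback.snd f ψ ⁻¹ᵁ (ψ ⁻¹ᵁ U) := by
      rw [← Scheme.Hom.comp_preimage, ← Scheme.Hom.comp_preimage, pullback.condition]
    rw [he] at h1
    rw [← morphismRestrict_ι] at h1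
    exact MorphismProperty.of_postcomp (W := @Smooth) (W' := @IsOpenImmersion) _ (ψ ⁻¹ᵁ U).ι
      inferInstance h1
  · intro i j hij
    refine Set.disjoint_left.mpr ?_
    rintro x ⟨y, rfl⟩ ⟨y', hy'⟩
    have h1 : pullback.fst f ψ (PreSemiStablePair.pullbackSection hS.comp_eq_id ψ i y) ∈ Set.range (τ i) := by
      rw [← Scheme.Hom.comp_apply, PreSemiStablePair.pullbackSection_fst]
      exact ⟨ψ y, rfl⟩
    have h2 : pullback.fst f ψ (PreSemiStablePair.pullbackSection hS.comp_eq_id ψ j y') ∈ Set.range (τ j) := by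
      rw [← Scheme.Hom.comp_apply, PreSemiStablePair.pullbackSection_fst]
      exact ⟨ψ y', rfl⟩
    rw [hy'] at h2
    exact Set.disjoint_left.mp (hS.pairwise_disjoint hij) h1 h2
  · intro i
    obtain ⟨U, hU, hsm⟩ := hS.exists_smooth i
    refine ⟨pullback.fst f ψ ⁻¹ᵁ U, ?_, ι_comp_pullback_snd_of_ι_comp (P := @Smooth) f ψ U hsm⟩
    rintro _ ⟨y, rfl⟩
    show pullback.fst f ψ (PreSemiStablePair.pullbackSection hS.comp_eq_id ψ i y) ∈ U
    rw [← Scheme.Hom.comp_apply, PreSemiStablePair.pullbackSection_fst]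
    exact hU ⟨ψ y, rfl⟩

end DeJong1996.SemiStablePair

end Literature.AlgebraicGeometry.Resolution

end
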